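import Summits.QuantumFields.YangMills.Theorems.BalabanUVNodesN09AxialCovariance181
import Summits.QuantumFields.YangMills.Theorems.BalabanUVNodesN09AtRecord13SepCoPHOnDomains

/-!
# NODE N09 — dag-n09-w3's ON-DOMAINS door `thm3Member_forall_stage13SepCoPH_onDomains_of_covariantOn` WITH ITS (181)ˢᵒˡ BINDER `hcov` REPLACED BY
# [B11] THM 1'S UNIQUENESS CLAUSE + THE AXIAL CONVENTION OF (2.3) ON THE SMALL-FIELD DOMAINS (FILE 5's mechanism at `S := domAltOfRecord θ.ν K (j+1)`)

TRACK A (YM-PLAN §2d, node N09 of 28), seat `pub-ymgap-dag-n09-w2` (D-0149 width seat 2∕4), generation g2, FILE 6.  Key of record: K1⁷ `StabilityBAtRecordR13SepCoPH` =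
stmt-QuantumFields-20542; `--supports` it as a helper (Summits lane).  [I] = [Balaban1987RG1] (CMP 109), [B11] = [Balaban1985Variational] (CMP 102).

WHY.  dag-n09-w3's FILE 5 (`BalabanUVNodesN09AtRecord13SepCoPHOnDomains`, p589797) is the most advanced N09 door: bookkeeping sets CHOSEN (`D (i+1) := regSetOfRecord K i ρ_i ∩
domAltOfRecord θ.ν K (i+1)`), every χ-hypothesis relativised to the fibres over the small-field domain of the next level and read a.e.; its §4 locates the selection clause at
[B11] (181): `hcov : ∀ P, ∀ j < P.K, ∀ v W, UkExists (j+1) θ.ν.εreg W → critCfgOfRecord θ.ν P.K j (W^v) = (critCfgOfRecord θ.ν P.K j W)^{v∘blockOf}` — unprovable for the bare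
choice.  This seat's FILE 5 (`BalabanUVNodesN09AxialCovariance181`) derives that covariance AT A COARSE FIELD from [B11] Thm 1's UNIQUENESS clause there and the AXIALITY of (2.3)
there and at its gauge images (`critCfgOfRecord_gaugeAct_of_uniqueOrbit_of_axial`; the block axial gauge is a complete gauge of the fine group).  Since `domAltOfRecord` is
gauge-stable (dag-n09-a `domAltOfRecord_gaugeAct_mem`), uniqueness + axiality ON THE DOMAIN `domAltOfRecord θ.ν K (j+1)` give (M1-dom) there — and w3's door re-keys with `hcov`
REPLACED by two hypotheses that mention only coarse fields OF THE SMALL-FIELD DOMAINS: `huniqDom` ([B11] Thm 1 uniqueness at radius `θ.ν.εreg` on `domAlt_{j+1}`; dag-n09-w1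
g2 derives it from the junction's `h11` + the radius transfer) and `haxDom` ([I] (2.3)'s axial convention on `domAlt_{j+1}` for a contour family, e.g. def-B's `contourOfRecord`).
* §1 `chiβ13_gaugeAct_liftTransf_ae_on_of_uniqueOrbit_of_axialOn` — (M1-dom) a.e. over `Ū⁻¹(domAlt_{j+1})` from `hsolv` + `huniqDom` + `haxDom` (FILE 5
  `chiβ_liftInvariantOn_of_uniqueOrbit_of_axialOn` at `S := domAltOfRecord θ.ν K (j+1)`, pointwise ⇒ a.e.).
* §2 ★★★ `thm3Member_forall_stage13SepCoPH_onDomains_of_uniqueOrbit_of_axialOn` — w3's `thm3Member_forall_stage13SepCoPH_onDomains` fed by §1: N24's `h09T` at a world bound to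
  the Stage-13 v1.7 construction from `hsolv`, `huniqDom`, `haxDom`, (F7a-dom) `hχreg`, (I19) `hint`, [B11] ×3 at radius `θ.εbg` (`h11 ∕ hres ∕ huniq`), the nesting `hnestreg` —
  NO χ-invariance hypothesis, NO covariance hypothesis, nothing about a coarse field off the small-field domains; `…_of_measurableUk` twin ((I19) ↦ (H-U), dag-n24-c
  `integrable_betaInput_stage13_of_measurableUk`); `b12_main_forall_…` corollary with N09's own leaf.
LOCATED (not settled here): `haxDom` is print's CONVENTION (2.3) for the record's `critCfgOfRecord` (FILE 5 prices the one-token re-point that makes it a theorem);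
`hsolv`∕`huniqDom` are [B11] Thm 1 at radius `θ.ν.εreg` on the domains (dag-n09-w1 g2's radius-transfer lane); (F7a-dom), (I19)∕(H-U), [B11] ×3 and the nesting stay displayed.

HONEST FRAMING: count-neutral composition BY NAME (FILE 5, dag-n09-w3's FILE 5, dag-n09-a's domain lemmas, dag-n24-c's junction); NOTHING of Bałaban's asserted; N09 NOT
discharged; K0⁷ ∕ K1⁷ OPEN; counts unmoved (typed 28∕28 · discharged 5∕27); R4 is the conditional finite-𝕋⁴ rung `BalabanLadder.UV` only — NOT continuum ∕ ℝ⁴ ∕ OS ∕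
mass gap ∕ Clay.  THEOREMS ONLY (0 `def`, 0 `sorry`), standard axioms.
-/

noncomputable section

namespace Summit.QuantumFields.YangMills.BalabanUVNodes.N09AxialCovariance181OnDomains

open MeasureTheory
open Literature.MathematicalPhysics.QuantumFieldTheory.Balaban1983to89
open Literature.MathematicalPhysics.QuantumFieldTheory.Balaban1983to89.Node00
open B12RTGaugeInvariance254 (liftTransf)
open B12ContinuousTransportInvarianceOn (domAltOfRecord_gaugeAct_mem)
open B12NodeKnitRecord13SepCoPH (integrable_betaInput_stage13_of_measurableUk)
open B12NodeKnitRecord8 (b12_main_of_leaf_of_thm3Member)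
open DagBinding
open GaugeField (gaugeAct)
open Summit.QuantumFields.YangMills.BalabanUVNodes.N09LiftInvariance29AtRecord (succ_le_range_of_lt)
open Summit.QuantumFields.YangMills.BalabanUVNodes.N09AxialCovariance181 (chiβ_liftInvariantOn_of_uniqueOrbit_of_axialOn)
open Summit.QuantumFields.YangMills.BalabanUVNodes.N09AtRecord13SepCoPHOnDomains (thm3Member_stage13SepCoPH_onDomains)

variable {F : T4Continuum.T4Family} {N : ℕ} [NeZero N]

/-! ## §1. (M1-dom) from [B11] uniqueness + the axial convention ON THE SMALL-FIELD DOMAIN of the next level -/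

/-- **(M1-dom) FROM UNIQUENESS + AXIALITY ON THE DOMAIN**: if every field of the small-field domain of level `j+1` is solvable at the cut-off's radius `ν.εreg` with a UNIQUE
minimal orbit ([B11] Thm 1), and the record's critical configuration (2.3) is in the block axial gauge of a contour system `cd j` of `T^{(j)}` at every field of that domain
([I] (2.3)'s convention), then `χ^{(2.9)}_j(U^{v∘blockOf}) = χ^{(2.9)}_j(U)` at EVERY (hence a.e.) `U` with `Ū ∈ domAltOfRecord ν K (j+1)` — FILE 5's
`chiβ_liftInvariantOn_of_uniqueOrbit_of_axialOn` on the gauge-stable set `S := domAltOfRecord ν K (j+1)` (dag-n09-a `domAltOfRecord_gaugeAct_mem`); the junk corner is never visited.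
[cite: Balaban1987RG1, (2.3) p.265 and (2.9) p.266; Balaban1985Variational, Thm 1 p.279 and (181) p.307] -/
theorem chiβ13_gaugeAct_liftTransf_ae_on_of_uniqueOrbit_of_axialOn (θ₀ : Stage13Params F N) (P : B12.RunParams)
    (cd : (j : ℕ) → ContourData (F.P P.K) j (SU N))
    (hsolv : ∀ j < P.K, ∀ W ∈ domAltOfRecord F N θ₀.ν P.K (j + 1), UkExists F N P.K (j + 1) θ₀.ν.εreg W)
    (huniqDom : ∀ j < P.K, ∀ W ∈ domAltOfRecord F N θ₀.ν P.K (j + 1), UniqueUkOrbit F N P.K (j + 1) θ₀.ν.εreg W)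
    (haxDom : ∀ j < P.K, ∀ W ∈ domAltOfRecord F N θ₀.ν P.K (j + 1), AxialGauge (cd j) (critCfgOfRecord F N θ₀.ν P.K j W)) :
    ∀ j < P.K, ∀ v : GaugeTransf (F.P P.K) (j + 1) (SU N), ∀ᵐ U ∂(fieldMeasure (F.P P.K) j (SU N)),
      (avOfRecord F N P.K j).avg U ∈ domAltOfRecord F N θ₀.ν P.K (j + 1) →
        chiβOfRecord₁₃ F N θ₀ P.K (gOfRecord₁₃ F N θ₀ P) j (gaugeAct (liftTransf v) U) = chiβOfRecord₁₃ F N θ₀ P.K (gOfRecord₁₃ F N θ₀ P) j U :=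
  fun j hj v => Filter.Eventually.of_forall fun U hU =>
    chiβ_liftInvariantOn_of_uniqueOrbit_of_axialOn θ₀ P.K (gOfRecord₁₃ F N θ₀ P) hj (cd j)
      (fun u W hW => domAltOfRecord_gaugeAct_mem θ₀.ν P.K (j + 1) u W hW) (hsolv j hj) (huniqDom j hj) (haxDom j hj) v U hU

/-- The pointwise (every `U`, not only a.e.) form of §1, for consumers reading (M1-dom) pointwise. [cite: Balaban1987RG1, (2.9) p.266; Balaban1985Variational, Thm 1 p.279] -/
theorem chiβ13_gaugeAct_liftTransf_on_of_uniqueOrbit_of_axialOn (θ₀ : Stage13Params F N) (P : B12.RunParams)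
    (cd : (j : ℕ) → ContourData (F.P P.K) j (SU N))
    (hsolv : ∀ j < P.K, ∀ W ∈ domAltOfRecord F N θ₀.ν P.K (j + 1), UkExists F N P.K (j + 1) θ₀.ν.εreg W)
    (huniqDom : ∀ j < P.K, ∀ W ∈ domAltOfRecord F N θ₀.ν P.K (j + 1), UniqueUkOrbit F N P.K (j + 1) θ₀.ν.εreg W)
    (haxDom : ∀ j < P.K, ∀ W ∈ domAltOfRecord F N θ₀.ν P.K (j + 1), AxialGauge (cd j) (critCfgOfRecord F N θ₀.ν P.K j W)) :
    ∀ j < P.K, ∀ (v : GaugeTransf (F.P P.K) (j + 1) (SU N)) (U : GaugeField (F.P P.K) j (SU N)),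
      (avOfRecord F N P.K j).avg U ∈ domAltOfRecord F N θ₀.ν P.K (j + 1) →
        chiβOfRecord₁₃ F N θ₀ P.K (gOfRecord₁₃ F N θ₀ P) j (gaugeAct (liftTransf v) U) = chiβOfRecord₁₃ F N θ₀ P.K (gOfRecord₁₃ F N θ₀ P) j U :=
  fun j hj v U hU =>
    chiβ_liftInvariantOn_of_uniqueOrbit_of_axialOn θ₀ P.K (gOfRecord₁₃ F N θ₀ P) hj (cd j)
      (fun u W hW => domAltOfRecord_gaugeAct_mem θ₀.ν P.K (j + 1) u W hW) (hsolv j hj) (huniqDom j hj) (haxDom j hj) v U hU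

/-! ## §2. dag-n09-w3's on-domains door with `hcov` REPLACED by uniqueness + axiality on the domains -/

/-- ★★★ **N24's `h09T` AT A WORLD BOUND TO THE STAGE-13 v1.7 CONSTRUCTION, ON THE SMALL-FIELD DOMAINS, SELECTION CLAUSE = [B11] UNIQUENESS + THE AXIAL CONVENTION**:
dag-n09-w3's `thm3Member_forall_stage13SepCoPH_onDomains_of_covariantOn` with its covariance binder `hcov` REPLACED by `huniqDom` (unique minimal orbit at radius `θ.ν.εreg` on
`domAltOfRecord θ.ν P.K (j+1)`, [B11] Thm 1) and `haxDom` (the record's (2.3) in the block axial gauge of `cd P j` there, [I] (2.3)); `hsolv`, (F7a-dom) `hχreg`, (I19) `hint`,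
[B11] ×3 at radius `θ.εbg` (`h11 ∕ hres ∕ huniq`), the nesting `hnestreg` VERBATIM.  NO χ-invariance hypothesis, NO hypothesis about a coarse field off the small-field domains.
CONDITIONAL on every displayed hypothesis; nothing of Bałaban asserted; N09 NOT discharged; K1⁷ NOT closed.
[cite: Balaban1987RG1, Thm 3 p.264, (1.1)–(1.3) p.260, (2.1)–(2.3) p.265, (2.9)–(2.10) pp.266–267; Balaban1985Variational, Thm 1 (8)–(10) p.279 and (181) p.307] -/
theorem thm3Member_forall_stage13SepCoPH_onDomains_of_uniqueOrbit_of_axialOn (θ : Stage13HParams F N) (h : θ.Provisos₁₃SepCoPH F N) {w : WorldP}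
    (hC : w.C = (datumOfRecord₁₃SepCoPH F N θ h).C) (cd : (P : B12.RunParams) → (j : ℕ) → ContourData (F.P P.K) j (SU N))
    (hsolv : ∀ (P : B12.RunParams), ∀ j < P.K, ∀ W ∈ domAltOfRecord F N θ.ν P.K (j + 1), UkExists F N P.K (j + 1) θ.ν.εreg W)
    (huniqDom : ∀ (P : B12.RunParams), ∀ j < P.K, ∀ W ∈ domAltOfRecord F N θ.ν P.K (j + 1), UniqueUkOrbit F N P.K (j + 1) θ.ν.εreg W)
    (haxDom : ∀ (P : B12.RunParams), ∀ j < P.K, ∀ W ∈ domAltOfRecord F N θ.ν P.K (j + 1), AxialGauge (cd P j) (critCfgOfRecord F N θ.ν P.K j W))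
    (hχreg : ∀ (P : B12.RunParams) (i : ℕ), i + 1 < P.K → ∀ᵐ U ∂(fieldMeasure (F.P P.K) (i + 1) (SU N)),
      (avOfRecord F N P.K (i + 1)).avg U ∈ domAltOfRecord F N θ.ν P.K (i + 2) →
        U ∉ regSetOfRecord F N P.K i (betaInputOfRecord F N (TβOfRecord₁₃ F N) (chiβOfRecord₁₃ F N θ.toStage13Params) P.K (gOfRecord₁₃ F N θ.toStage13Params P) i) ∩
            domAltOfRecord F N θ.ν P.K (i + 1) →
          chiβOfRecord₁₃ F N θ.toStage13Params P.K (gOfRecord₁₃ F N θ.toStage13Params P) (i + 1) U = 0)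
    (hint : ∀ (P : B12.RunParams), ∀ j < P.K, Integrable (betaInputOfRecord F N (TβOfRecord₁₃ F N) (chiβOfRecord₁₃ F N θ.toStage13Params) P.K
      (gOfRecord₁₃ F N θ.toStage13Params P) j) (fieldMeasure (F.P P.K) j (SU N)))
    (h11 : ∀ (P : B12.RunParams) (k : ℕ), k ≤ P.K → ∀ V ∈ domAltOfRecord F N θ.ν P.K k, UkExists F N P.K k θ.εbg V ∧ UniqueUkOrbit F N P.K k θ.εbg V)
    (hres : ∀ (P : B12.RunParams) (k : ℕ), k ≤ P.K → HRestrict F N θ.εbg P.K k (domAltOfRecord F N θ.ν P.K k))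
    (huniq : ∀ (P : B12.RunParams) (k : ℕ), k ≤ P.K → ∀ V ∈ domAltOfRecord F N θ.ν P.K k, ∀ j < k,
      UniqueUkOrbit F N P.K (j + 1) θ.εbg (Averaging.iter (avOfRecord F N P.K) (j + 1) (Uk F N P.K k θ.εbg V)))
    (hnestreg : ∀ (P : B12.RunParams) (k : ℕ), k ≤ P.K → ∀ V ∈ domAltOfRecord F N θ.ν P.K k, ∀ i, i + 1 < k →
      Averaging.iter (avOfRecord F N P.K) (i + 1) (Uk F N P.K k θ.εbg V) ∈
        regSetOfRecord F N P.K i (betaInputOfRecord F N (TβOfRecord₁₃ F N) (chiβOfRecord₁₃ F N θ.toStage13Params) P.K (gOfRecord₁₃ F N θ.toStage13Params P) i) ∩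
          domAltOfRecord F N θ.ν P.K (i + 1)) :
    ∀ P : B12.RunParams, (leavesP w P).smallCouplings → (leavesP w P).smallFieldInductive :=
  fun P => thm3Member_stage13SepCoPH_onDomains θ h hC P
    (chiβ13_gaugeAct_liftTransf_ae_on_of_uniqueOrbit_of_axialOn θ.toStage13Params P (cd P) (hsolv P) (huniqDom P) (haxDom P))
    (hχreg P) (hint P) (h11 P) (hres P) (huniq P) (hnestreg P)

/-- **THE SAME WITH (I19) REPLACED BY (H-U)** (measurability of the level-`(k+1)` minimiser selection at radius `θ.ν.εreg`; dag-n24-c `integrable_betaInput_stage13_of_measurableUk`;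
dag-n09-w4's measurable selector is the priced supplier after the re-point).  CONDITIONAL; N09 NOT discharged; K1⁷ NOT closed.
[cite: Balaban1987RG1, Thm 3 p.264, (0.19) p.255, (2.1)–(2.3) p.265, (2.9)–(2.10) pp.266–267; Balaban1985Variational, Thm 1 (8)–(10) p.279 and (181) p.307] -/
theorem thm3Member_forall_stage13SepCoPH_onDomains_of_uniqueOrbit_of_axialOn_of_measurableUk (θ : Stage13HParams F N) (h : θ.Provisos₁₃SepCoPH F N) {w : WorldP}
    (hC : w.C = (datumOfRecord₁₃SepCoPH F N θ h).C) (cd : (P : B12.RunParams) → (j : ℕ) → ContourData (F.P P.K) j (SU N))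
    (hsolv : ∀ (P : B12.RunParams), ∀ j < P.K, ∀ W ∈ domAltOfRecord F N θ.ν P.K (j + 1), UkExists F N P.K (j + 1) θ.ν.εreg W)
    (huniqDom : ∀ (P : B12.RunParams), ∀ j < P.K, ∀ W ∈ domAltOfRecord F N θ.ν P.K (j + 1), UniqueUkOrbit F N P.K (j + 1) θ.ν.εreg W)
    (haxDom : ∀ (P : B12.RunParams), ∀ j < P.K, ∀ W ∈ domAltOfRecord F N θ.ν P.K (j + 1), AxialGauge (cd P j) (critCfgOfRecord F N θ.ν P.K j W))
    (hU : ∀ (P : B12.RunParams) (k : ℕ), k < P.K → Measurable (Uk F N P.K (k + 1) θ.ν.εreg))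
    (hχreg : ∀ (P : B12.RunParams) (i : ℕ), i + 1 < P.K → ∀ᵐ U ∂(fieldMeasure (F.P P.K) (i + 1) (SU N)),
      (avOfRecord F N P.K (i + 1)).avg U ∈ domAltOfRecord F N θ.ν P.K (i + 2) →
        U ∉ regSetOfRecord F N P.K i (betaInputOfRecord F N (TβOfRecord₁₃ F N) (chiβOfRecord₁₃ F N θ.toStage13Params) P.K (gOfRecord₁₃ F N θ.toStage13Params P) i) ∩
            domAltOfRecord F N θ.ν P.K (i + 1) →
          chiβOfRecord₁₃ F N θ.toStage13Params P.K (gOfRecord₁₃ F N θ.toStage13Params P) (i + 1) U = 0)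
    (h11 : ∀ (P : B12.RunParams) (k : ℕ), k ≤ P.K → ∀ V ∈ domAltOfRecord F N θ.ν P.K k, UkExists F N P.K k θ.εbg V ∧ UniqueUkOrbit F N P.K k θ.εbg V)
    (hres : ∀ (P : B12.RunParams) (k : ℕ), k ≤ P.K → HRestrict F N θ.εbg P.K k (domAltOfRecord F N θ.ν P.K k))
    (huniq : ∀ (P : B12.RunParams) (k : ℕ), k ≤ P.K → ∀ V ∈ domAltOfRecord F N θ.ν P.K k, ∀ j < k,
      UniqueUkOrbit F N P.K (j + 1) θ.εbg (Averaging.iter (avOfRecord F N P.K) (j + 1) (Uk F N P.K k θ.εbg V)))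
    (hnestreg : ∀ (P : B12.RunParams) (k : ℕ), k ≤ P.K → ∀ V ∈ domAltOfRecord F N θ.ν P.K k, ∀ i, i + 1 < k →
      Averaging.iter (avOfRecord F N P.K) (i + 1) (Uk F N P.K k θ.εbg V) ∈
        regSetOfRecord F N P.K i (betaInputOfRecord F N (TβOfRecord₁₃ F N) (chiβOfRecord₁₃ F N θ.toStage13Params) P.K (gOfRecord₁₃ F N θ.toStage13Params P) i) ∩
          domAltOfRecord F N θ.ν P.K (i + 1)) :
    ∀ P : B12.RunParams, (leavesP w P).smallCouplings → (leavesP w P).smallFieldInductive :=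
  fun P => thm3Member_stage13SepCoPH_onDomains θ h hC P
    (chiβ13_gaugeAct_liftTransf_ae_on_of_uniqueOrbit_of_axialOn θ.toStage13Params P (cd P) (hsolv P) (huniqDom P) (haxDom P))
    (hχreg P) (integrable_betaInput_stage13_of_measurableUk θ.toStage13Params P (hU P)) (h11 P) (hres P) (huniq P) (hnestreg P)

/-- **N09 = `Dag.B12_main` AT EVERY RUN OF A WORLD BOUND TO THE STAGE-13 v1.7 CONSTRUCTION**, from N09's own leaf `b12` ([I] Lemma 4) and the inputs of
`thm3Member_forall_stage13SepCoPH_onDomains_of_uniqueOrbit_of_axialOn` (dag-n09-a `b12_main_of_leaf_of_thm3Member`).  CONDITIONAL; N09 NOT discharged.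
[cite: Balaban1987RG1, Lemma 4 (3.53) p.280, Thm 3 p.264 and (2.3) p.265; Balaban1985Variational, Thm 1 p.279 and (181) p.307] -/
theorem b12_main_forall_stage13SepCoPH_onDomains_of_uniqueOrbit_of_axialOn (θ : Stage13HParams F N) (h : θ.Provisos₁₃SepCoPH F N) {w : WorldP}
    (hC : w.C = (datumOfRecord₁₃SepCoPH F N θ h).C) (h12 : ∀ P : B12.RunParams, (leavesP w P).b12)
    (cd : (P : B12.RunParams) → (j : ℕ) → ContourData (F.P P.K) j (SU N))
    (hsolv : ∀ (P : B12.RunParams), ∀ j < P.K, ∀ W ∈ domAltOfRecord F N θ.ν P.K (j + 1), UkExists F N P.K (j + 1) θ.ν.εreg W)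
    (huniqDom : ∀ (P : B12.RunParams), ∀ j < P.K, ∀ W ∈ domAltOfRecord F N θ.ν P.K (j + 1), UniqueUkOrbit F N P.K (j + 1) θ.ν.εreg W)
    (haxDom : ∀ (P : B12.RunParams), ∀ j < P.K, ∀ W ∈ domAltOfRecord F N θ.ν P.K (j + 1), AxialGauge (cd P j) (critCfgOfRecord F N θ.ν P.K j W))
    (hχreg : ∀ (P : B12.RunParams) (i : ℕ), i + 1 < P.K → ∀ᵐ U ∂(fieldMeasure (F.P P.K) (i + 1) (SU N)),
      (avOfRecord F N P.K (i + 1)).avg U ∈ domAltOfRecord F N θ.ν P.K (i + 2) →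
        U ∉ regSetOfRecord F N P.K i (betaInputOfRecord F N (TβOfRecord₁₃ F N) (chiβOfRecord₁₃ F N θ.toStage13Params) P.K (gOfRecord₁₃ F N θ.toStage13Params P) i) ∩
            domAltOfRecord F N θ.ν P.K (i + 1) →
          chiβOfRecord₁₃ F N θ.toStage13Params P.K (gOfRecord₁₃ F N θ.toStage13Params P) (i + 1) U = 0)
    (hint : ∀ (P : B12.RunParams), ∀ j < P.K, Integrable (betaInputOfRecord F N (TβOfRecord₁₃ F N) (chiβOfRecord₁₃ F N θ.toStage13Params) P.K
      (gOfRecord₁₃ F N θ.toStage13Params P) j) (fieldMeasure (F.P P.K) j (SU N)))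
    (h11 : ∀ (P : B12.RunParams) (k : ℕ), k ≤ P.K → ∀ V ∈ domAltOfRecord F N θ.ν P.K k, UkExists F N P.K k θ.εbg V ∧ UniqueUkOrbit F N P.K k θ.εbg V)
    (hres : ∀ (P : B12.RunParams) (k : ℕ), k ≤ P.K → HRestrict F N θ.εbg P.K k (domAltOfRecord F N θ.ν P.K k))
    (huniq : ∀ (P : B12.RunParams) (k : ℕ), k ≤ P.K → ∀ V ∈ domAltOfRecord F N θ.ν P.K k, ∀ j < k,
      UniqueUkOrbit F N P.K (j + 1) θ.εbg (Averaging.iter (avOfRecord F N P.K) (j + 1) (Uk F N P.K k θ.εbg V)))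
    (hnestreg : ∀ (P : B12.RunParams) (k : ℕ), k ≤ P.K → ∀ V ∈ domAltOfRecord F N θ.ν P.K k, ∀ i, i + 1 < k →
      Averaging.iter (avOfRecord F N P.K) (i + 1) (Uk F N P.K k θ.εbg V) ∈
        regSetOfRecord F N P.K i (betaInputOfRecord F N (TβOfRecord₁₃ F N) (chiβOfRecord₁₃ F N θ.toStage13Params) P.K (gOfRecord₁₃ F N θ.toStage13Params P) i) ∩
          domAltOfRecord F N θ.ν P.K (i + 1)) :
    ∀ P : B12.RunParams, Dag.B12_main (leavesP w P) :=
  fun P => b12_main_of_leaf_of_thm3Member (h12 P)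
    (thm3Member_forall_stage13SepCoPH_onDomains_of_uniqueOrbit_of_axialOn θ h hC cd hsolv huniqDom haxDom hχreg hint h11 hres huniq hnestreg P)

end Summit.QuantumFields.YangMills.BalabanUVNodes.N09AxialCovariance181OnDomains
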